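import Summits.QuantumFields.GaugeBoot.HaarShiftDLR
import Summits.QuantumFields.GaugeBoot.ClassBNegativeCouplingAllReps
import Summits.QuantumFields.GaugeBoot.ClassBLimitSymmetry
import Literature.MathematicalPhysics.QuantumFieldTheory.WilsonAxisSymmetry
import HarnessLib

/-!
# The loop equations determine the state at strong coupling; Class T is empty at small negative coupling in every dimension (gauge-boot, Class B / Class T)

HONEST FRAMING (cell `pub-gaugeboot`, page 1 of every file): the venture produces certified bounds
on lattice expectations at stated coupling, gauge group, dimension and torus size; NOT a mass gap,
NOT a continuum limit, NOT a string tension; NOT Yang–Mills-summit-bearing (barriers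
`FixedCouplingUltralocality`, `PerturbativeInvisibility`). This module is a STRONG-COUPLING
structural statement (`6(d-1) N |β| < 1`, Dobrushin's regime); nothing is claimed at the couplings
of the cell's certificates.

## Content

`HaarShiftDLR.lean` identified the Haar-shift (one-link Schwinger–Dyson) probability states with
the DLR states of the Wilson specification. Combined with the tree's Dobrushin uniqueness for every
compact gauge group (`subsingleton_ymGibbsMeasures_allGroups`, `6(d-1) N |β| < 1`, either sign of
`β`) and the symmetries of the torus limit points (`ClassBLimitSymmetry.lean`):

* ★★ `IsHaarShiftState.eq_of_small` — **at strong coupling the loop equations alone determine the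
  state**: any two Haar-shift probability states at the same `β` with `6(d-1) N |β| < 1` coincide;
  each equals every infinite-volume torus limit point (`…eq_of_mem_infiniteVolumeLimitPoints_of_small`),
  hence IS a torus limit point (`…mem_infiniteVolumeLimitPoints_of_small`) and inherits all lattice
  symmetries (`…isZdTranslationInvariant_of_small`, `…map_configPermZd_of_small`);
  consequently a Class-B or Class-T certificate at such `β` bounds exactly THE thermodynamic-limit
  state (`ClassBState.μ_eq_of_small`, `TiltedRP.TiltedClassState.μ_eq_of_small`,
  `…μ_mem_infiniteVolumeLimitPoints_of_small`).
* ★★★ `false_of_haarShift_diagRP_of_neg_of_small` — **at small NEGATIVE coupling a single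
  diagonal reflection positivity is already inconsistent with the loop equations**: for
  `-1/(6(d-1)N) < β < 0`, `ρ` non-trivial (`∃ g, Re tr ρ(g) ≠ N`) and any `i ≠ j`, no Haar-shift
  probability state is reflection positive in the diagonal mirror `x_i = x_j`. Proof: the state is
  the unique DLR state, hence invariant under all axis permutations and translations, so every
  plaquette has the expectation of the `(i, j)`-plaquette at the origin
  (`integral_plaquetteObs_zero_eq_of_map_configPermZd`), which the mirror-cut (projected cut)
  positivity bounds below by `m₀(ρ) = ∫ Re tr ρ dHaar`
  (`integral_re_trace_plaquette_ge_of_isReflectionPositiveFor_diag`), contradicting the DLR sign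
  rule `Σ_{p ∋ e} u_p < #{p ∋ e} m₀(ρ)` at `β < 0` (`IsHaarShiftState.sum_integral_plaquetteObs_lt_of_neg`).
* ★★★ `TiltedRP.TiltedClassState.false_of_neg_of_small`, `TiltedRP.isEmpty_tiltedClassState_of_neg_of_small`,
  `TiltedRP.nonempty_tiltedClassState_iff_of_small` — **CLASS T IS EMPTY AT SMALL NEGATIVE
  COUPLING IN EVERY DIMENSION `d ≥ 2`** and, for `6(d-1) N |β| < 1`,
  `Nonempty (TiltedClassState d i j ρ β) ↔ (0 ≤ β ∨ ∀ g, ρ g = 1)`; `SU(N)` and `U(N)` forms. The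
  two-dimensional case was known for every `β < 0` (`nonempty_tiltedClassState_two_iff_all`); in
  `d ≥ 3` the question "PLAIN Class T at `β < 0`" (lean3 gens 61–69) was open — this settles its
  strong-coupling corner; moderate `β < 0` in `d ≥ 3` remains open (no plaquette-sign argument can
  decide it, `LinkRPPlainVsCovariant.lean`).

References: R. L. Dobrushin, Theory Probab. Appl. 13 (1968) 197; H.-O. Georgii, *Gibbs Measures and
Phase Transitions* (2011) Thm. 1.33, Ch. 8; K. Osterwalder, E. Seiler, Ann. Phys. 110 (1978) 440 §2;
V. Kazakov, Z. Zheng, arXiv:2203.11360 §3.1, arXiv:2404.16925 §3.2. The statements about Class B /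
Class T are the cell's own (structural, no certificate); uniqueness at strong coupling is folklore.
-/

noncomputable section

open MeasureTheory
open scoped ComplexOrder ComplexConjugate
open Literature.Probability.LatticeModels (Site)
open Literature.MathematicalPhysics.QuantumLattice
open Literature.MathematicalPhysics.QuantumFieldTheory (haarProbability configPermZd
  plaquetteObs_configPermZd sitePermZd_zero)

namespace Summit.QuantumFields.GaugeBoot

variable {d N : ℕ} {G : Type} [Group G] [TopologicalSpace G] [IsTopologicalGroup G]
  [CompactSpace G] [MeasurableSpace G] [BorelSpace G] [T2Space G] [SecondCountableTopology G]
variable (ρ : G →* Matrix (Fin N) (Fin N) ℂ)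

/-! ## At strong coupling the loop equations determine the state -/

section Unique

/-- ★★ **Uniqueness of the Haar-shift state at strong coupling**: for `G` compact metrisable,
`ρ` continuous and `6(d-1) N |β| < 1` (either sign of `β`), any two probability measures on the
gauge configurations of `ℤ^d` obeying the one-link Haar-shift identity at `β` coincide — the
measure form of "the loop equations have a unique solution at strong coupling" (Haar-shift states
are DLR states, `mem_ymGibbsMeasures_of_isHaarShiftState`; Dobrushin uniqueness
`subsingleton_ymGibbsMeasures_allGroups`). [folklore] -/
theorem IsHaarShiftState.eq_of_small (hρ : Continuous ρ) {β : ℝ}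
    (hβ : 6 * ((d - 1 : ℕ) : ℝ) * N * |β| < 1) {μ ν : Measure (LGConfig d G)}
    [IsProbabilityMeasure μ] [IsProbabilityMeasure ν] (hμ : IsHaarShiftState ρ β μ)
    (hν : IsHaarShiftState ρ β ν) : μ = ν :=
  subsingleton_ymGibbsMeasures_allGroups ρ hρ hβ (mem_ymGibbsMeasures_of_isHaarShiftState ρ hρ hμ)
    (mem_ymGibbsMeasures_of_isHaarShiftState ρ hρ hν)

/-- ★★ **A Haar-shift state at strong coupling equals every torus limit point** (torus limit
points are DLR states, `mem_ymGibbsMeasures_of_mem_infiniteVolumeLimitPoints_holds`). [folklore] -/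
theorem IsHaarShiftState.eq_of_mem_infiniteVolumeLimitPoints_of_small (hρ : Continuous ρ) {β : ℝ}
    (hβ : 6 * ((d - 1 : ℕ) : ℝ) * N * |β| < 1) {μ ν : Measure (LGConfig d G)}
    [IsProbabilityMeasure μ] (hμ : IsHaarShiftState ρ β μ)
    (hν : ν ∈ infiniteVolumeLimitPoints (d := d) ρ β) : μ = ν :=
  subsingleton_ymGibbsMeasures_allGroups ρ hρ hβ (mem_ymGibbsMeasures_of_isHaarShiftState ρ hρ hμ)
    (mem_ymGibbsMeasures_of_mem_infiniteVolumeLimitPoints_holds ρ hρ hν)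

/-- ★★ **A Haar-shift state at strong coupling IS an infinite-volume limit point of the torus
Wilson states** (limit points exist by compactness, and the state equals each of them). [folklore] -/
theorem IsHaarShiftState.mem_infiniteVolumeLimitPoints_of_small (hρ : Continuous ρ) {β : ℝ}
    (hβ : 6 * ((d - 1 : ℕ) : ℝ) * N * |β| < 1) {μ : Measure (LGConfig d G)}
    [IsProbabilityMeasure μ] (hμ : IsHaarShiftState ρ β μ) :
    μ ∈ infiniteVolumeLimitPoints (d := d) ρ β := by
  obtain ⟨ν, hν⟩ := infiniteVolumeLimitPoints_nonempty_holds (d := d) ρ hρ β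
  rw [hμ.eq_of_mem_infiniteVolumeLimitPoints_of_small ρ hρ hβ hν]
  exact hν

/-- A Haar-shift state at strong coupling is translation invariant (it is a torus limit point). -/
theorem IsHaarShiftState.isZdTranslationInvariant_of_small (hρ : Continuous ρ) {β : ℝ}
    (hβ : 6 * ((d - 1 : ℕ) : ℝ) * N * |β| < 1) {μ : Measure (LGConfig d G)}
    [IsProbabilityMeasure μ] (hμ : IsHaarShiftState ρ β μ) : IsZdTranslationInvariant μ :=
  isZdTranslationInvariant_of_mem_infiniteVolumeLimitPoints ρ
    (hμ.mem_infiniteVolumeLimitPoints_of_small ρ hρ hβ)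

/-- A Haar-shift state at strong coupling is invariant under every permutation of the axes (it is
a torus limit point, `map_configPermZd_eq_of_mem_infiniteVolumeLimitPoints`). -/
theorem IsHaarShiftState.map_configPermZd_of_small (hρ : Continuous ρ) {β : ℝ}
    (hβ : 6 * ((d - 1 : ℕ) : ℝ) * N * |β| < 1) {μ : Measure (LGConfig d G)}
    [IsProbabilityMeasure μ] (hμ : IsHaarShiftState ρ β μ) (π : Equiv.Perm (Fin d)) :
    μ.map (configPermZd π) = μ :=
  map_configPermZd_eq_of_mem_infiniteVolumeLimitPoints ρ hρ
    (hμ.mem_infiniteVolumeLimitPoints_of_small ρ hρ hβ) π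

/-- A Haar-shift state at strong coupling is invariant under every coordinate reflection
`x_m ↦ -x_m` (it is a torus limit point, `reflectInvariant_of_mem_infiniteVolumeLimitPoints`). -/
theorem IsHaarShiftState.reflectInvariant_of_small [NeZero d] (hρ : Continuous ρ) {β : ℝ}
    (hβ : 6 * ((d - 1 : ℕ) : ℝ) * N * |β| < 1) {μ : Measure (LGConfig d G)}
    [IsProbabilityMeasure μ] (hμ : IsHaarShiftState ρ β μ) (m : Fin d) :
    MeasurePreserving (configSiteReflect m) μ μ :=
  reflectInvariant_of_mem_infiniteVolumeLimitPoints ρ hρ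
    (hμ.mem_infiniteVolumeLimitPoints_of_small ρ hρ hβ) m

/-- ★★ **At strong coupling all Class-B states have the same measure** — THE infinite-volume DLR
state: a Class-B certificate at `6(d-1) N |β| < 1` bounds exactly the thermodynamic-limit
expectations. -/
theorem ClassBState.μ_eq_of_small (hρ : Continuous ρ) {β : ℝ}
    (hβ : 6 * ((d - 1 : ℕ) : ℝ) * N * |β| < 1) (ω ω' : ClassBState d ρ β) : ω.μ = ω'.μ := by
  haveI := ω.isProbabilityMeasure
  haveI := ω'.isProbabilityMeasure
  exact ω.haarShift.eq_of_small ρ hρ hβ ω'.haarShift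

/-- ★★ At strong coupling the measure of every Class-B state is an infinite-volume limit point of
the torus Wilson states (and equals each of them). -/
theorem ClassBState.μ_mem_infiniteVolumeLimitPoints_of_small (hρ : Continuous ρ) {β : ℝ}
    (hβ : 6 * ((d - 1 : ℕ) : ℝ) * N * |β| < 1) (ω : ClassBState d ρ β) :
    ω.μ ∈ infiniteVolumeLimitPoints (d := d) ρ β := by
  haveI := ω.isProbabilityMeasure
  exact ω.haarShift.mem_infiniteVolumeLimitPoints_of_small ρ hρ hβ

/-- ★★ **At strong coupling all Class-T states have the same measure** — THE infinite-volume DLR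
state (so Class-T, Class-B and torus-limit-point certificates bound the same number there). -/
theorem TiltedRP.TiltedClassState.μ_eq_of_small {i j : Fin d} (hρ : Continuous ρ) {β : ℝ}
    (hβ : 6 * ((d - 1 : ℕ) : ℝ) * N * |β| < 1) (ω ω' : TiltedRP.TiltedClassState d i j ρ β) :
    ω.μ = ω'.μ := by
  haveI := ω.isProbabilityMeasure
  haveI := ω'.isProbabilityMeasure
  exact ω.haarShift.eq_of_small ρ hρ hβ ω'.haarShift

/-- ★★ At strong coupling the measure of every Class-T state is an infinite-volume limit point of
the (cubic!) torus Wilson states. -/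
theorem TiltedRP.TiltedClassState.μ_mem_infiniteVolumeLimitPoints_of_small {i j : Fin d}
    (hρ : Continuous ρ) {β : ℝ} (hβ : 6 * ((d - 1 : ℕ) : ℝ) * N * |β| < 1)
    (ω : TiltedRP.TiltedClassState d i j ρ β) : ω.μ ∈ infiniteVolumeLimitPoints (d := d) ρ β := by
  haveI := ω.isProbabilityMeasure
  exact ω.haarShift.mem_infiniteVolumeLimitPoints_of_small ρ hρ hβ

end Unique

/-! ## Plaquette expectations of a permutation-invariant state do not depend on the plane -/

section Plane

omit [TopologicalSpace G] [IsTopologicalGroup G] [CompactSpace G] [BorelSpace G] [T2Space G]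
  [SecondCountableTopology G] in
/-- **In a state invariant under all axis permutations every plaquette at the origin has the same
expectation**: `∫ u_{0,ab} dμ = ∫ u_{0,ij} dμ` for `a ≠ b`, `i ≠ j` (a permutation with
`σ i = a`, `σ j = b` exists by `exists_perm_apply_eq` of `OrbitAverages.lean`). -/
theorem integral_plaquetteObs_zero_eq_of_map_configPermZd {μ : Measure (LGConfig d G)}
    (hperm : ∀ π : Equiv.Perm (Fin d), μ.map (configPermZd π) = μ) {i j a b : Fin d}
    (hij : i ≠ j) (hab : a ≠ b) :
    ∫ U, plaquetteObs ρ 0 a b U ∂μ = ∫ U, plaquetteObs ρ 0 i j U ∂μ := by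
  obtain ⟨σ, hσi, hσj⟩ := exists_perm_apply_eq (d := d) hab hij
  conv_rhs => rw [← hperm σ.symm]
  rw [integral_map_equiv]
  refine integral_congr_ae (ae_of_all _ fun U => ?_)
  show plaquetteObs ρ 0 a b U = plaquetteObs ρ 0 i j (configPermZd σ.symm U)
  rw [plaquetteObs_configPermZd, sitePermZd_zero, Equiv.symm_symm, hσi, hσj]

end Plane

/-! ## One diagonal reflection positivity is inconsistent with the loop equations at small `β < 0` -/

section Negative

/-- ★★★ **At small negative coupling no Haar-shift state is reflection positive in ANY single
diagonal mirror.** `G` compact metrisable, `ρ` continuous and non-trivial (`∃ g, Re tr ρ(g) ≠ N`),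
`i ≠ j` in `Fin d` (so `d ≥ 2`), `β < 0` with `6(d-1) N |β| < 1`, `μ` a probability measure obeying
the one-link Haar-shift identity at `β` and reflection positive for the diagonal mirror
`x_i = x_j`. Then `False`. (The state is the unique DLR state, hence permutation and translation
invariant; every plaquette then has the expectation of the `(i,j)`-plaquette at the origin, which
the mirror-cut positivity bounds below by `m₀(ρ) = ∫ Re tr ρ dHaar`, against the DLR sign rule
`Σ_{p ∋ e} u_p < #{p ∋ e} · m₀(ρ)`.) Compare `false_of_translationInvariant_haarShift_diagRP_of_neg_of_ne_one`
(every `β < 0`, but diagonal RP in ALL planes and translation invariance assumed). -/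
theorem false_of_haarShift_diagRP_of_neg_of_small (hρ : Continuous ρ)
    (hρ1 : ∃ g, ((ρ g).trace).re ≠ N) {i j : Fin d} (hij : i ≠ j) {β : ℝ} (hβ : β < 0)
    (hsmall : 6 * ((d - 1 : ℕ) : ℝ) * N * |β| < 1) {μ : Measure (LGConfig d G)}
    [IsProbabilityMeasure μ] (hH : IsHaarShiftState ρ β μ)
    (hRP : IsReflectionPositiveFor (configDiagSwapZd (G := G) i j) (diagHalfEdges i j) μ) :
    False := by
  have hd : 2 ≤ d := two_le_of_ne hij
  have hT : IsZdTranslationInvariant μ := hH.isZdTranslationInvariant_of_small ρ hρ hsmall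
  have hperm : ∀ π : Equiv.Perm (Fin d), μ.map (configPermZd π) = μ := fun π =>
    hH.map_configPermZd_of_small ρ hρ hsmall π
  set e : ZdEdge d := ((0 : Fin d → ℤ), i) with he
  have hlt := hH.sum_integral_plaquetteObs_lt_of_neg ρ hρ hρ1 hd hβ e
  have h0 := integral_re_trace_plaquette_ge_of_isReflectionPositiveFor_diag ρ hρ hij hRP
  have hge : ∀ p ∈ plaquettesTouching ({e} : Finset (ZdEdge d)),
      ∫ g, ((ρ g).trace).re ∂(haarProbability G) ≤
        ∫ U, plaquetteObs ρ p.1 p.2.1.1 p.2.1.2 U ∂μ := by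
    intro p _
    have hp : p.2.1.1 ≠ p.2.1.2 := ne_of_lt p.2.2
    -- translation invariance moves the plaquette to the origin of its plane
    have hTr : ∫ U, plaquetteObs ρ p.1 p.2.1.1 p.2.1.2 U ∂μ =
        ∫ U, plaquetteObs ρ 0 p.2.1.1 p.2.1.2 U ∂μ := by
      conv_lhs => rw [← hT p.1]
      rw [integral_map_equiv]
      refine integral_congr_ae (ae_of_all _ fun U => ?_)
      have h := plaquetteHolonomyZd_configShift_add p.1 U 0 p.2.1.1 p.2.1.2
      rw [zero_add] at h
      simp only [plaquetteObs, h]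
    -- permutation invariance moves the plane to `(i, j)`
    rw [hTr, integral_plaquetteObs_zero_eq_of_map_configPermZd ρ hperm hij hp]
    simpa only [plaquetteObs] using h0
  have hsum := Finset.sum_le_sum hge
  rw [Finset.sum_const, nsmul_eq_mul] at hsum
  linarith

/-- ★★★ **NO CLASS-T STATE AT SMALL NEGATIVE COUPLING, IN EVERY DIMENSION**: for `G` compact
metrisable, `ρ` continuous and non-trivial, `i ≠ j` and `-1/(6(d-1)N) < β < 0`, the structure
`TiltedClassState d i j ρ β` (translation/swap/reflection invariant Haar-shift state with diagonal
RP in `x_i = x_j` and site/link RP across the other axes) has no inhabitant. Only the Haar-shift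
identity and the one diagonal RP are used. New for `d ≥ 3` (for `d = 2` and every `β < 0`:
`TiltedClassState.false_of_neg_two_of_ne_one`). -/
theorem TiltedRP.TiltedClassState.false_of_neg_of_small {i j : Fin d} (hij : i ≠ j)
    (hρ : Continuous ρ) (hρ1 : ∃ g, ((ρ g).trace).re ≠ N) {β : ℝ} (hβ : β < 0)
    (hsmall : 6 * ((d - 1 : ℕ) : ℝ) * N * |β| < 1) (ω : TiltedRP.TiltedClassState d i j ρ β) :
    False := by
  haveI := ω.isProbabilityMeasure
  exact false_of_haarShift_diagRP_of_neg_of_small ρ hρ hρ1 hij hβ hsmall ω.haarShift ω.diagRP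

/-- ★★★ `TiltedClassState d i j ρ β` is an EMPTY type for `-1/(6(d-1)N) < β < 0`, `ρ` non-trivial,
`i ≠ j`, every `d ≥ 2`. -/
theorem TiltedRP.isEmpty_tiltedClassState_of_neg_of_small {i j : Fin d} (hij : i ≠ j)
    (hρ : Continuous ρ) (hρ1 : ∃ g, ((ρ g).trace).re ≠ N) {β : ℝ} (hβ : β < 0)
    (hsmall : 6 * ((d - 1 : ℕ) : ℝ) * N * |β| < 1) :
    IsEmpty (TiltedRP.TiltedClassState d i j ρ β) :=
  ⟨fun ω => TiltedRP.TiltedClassState.false_of_neg_of_small ρ hij hρ hρ1 hβ hsmall ω⟩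

/-- ★★★ **Class T near `β = 0`, every dimension, every representation**: for `G` compact
metrisable, `ρ` continuous, `i ≠ j` and `6(d-1) N |β| < 1`:
`Nonempty (TiltedClassState d i j ρ β) ↔ (0 ≤ β ∨ ∀ g, ρ g = 1)` (`β ≥ 0`: tilted limit points,
`nonempty_tiltedClassState`; trivial `ρ`: the `β = 0` states qualify; otherwise empty by
`TiltedClassState.false_of_neg_of_small`). The `d = 2` statement for every real `β` is
`nonempty_tiltedClassState_two_iff_all`. -/
theorem TiltedRP.nonempty_tiltedClassState_iff_of_small {i j : Fin d} (hij : i ≠ j)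
    (hρ : Continuous ρ) {β : ℝ} (hsmall : 6 * ((d - 1 : ℕ) : ℝ) * N * |β| < 1) :
    Nonempty (TiltedRP.TiltedClassState d i j ρ β) ↔ (0 ≤ β ∨ ∀ g, ρ g = 1) := by
  constructor
  · rintro ⟨ω⟩
    by_contra h
    push Not at h
    obtain ⟨hβ, g, hg⟩ := h
    exact TiltedRP.TiltedClassState.false_of_neg_of_small ρ hij hρ
      ⟨g, re_trace_ne_card_of_ne_one ρ hρ hg⟩ hβ hsmall ω
  · rintro (hβ | h)
    · exact TiltedRP.nonempty_tiltedClassState ρ hij hρ hβ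
    · exact TiltedRP.nonempty_tiltedClassState_of_trivial ρ h
        (TiltedRP.nonempty_tiltedClassState ρ hij hρ le_rfl)

end Negative

/-! ## `SU(N)` and `U(N)` -/

section Unitary

open Literature.MathematicalPhysics.QuantumFieldTheory in
/-- ★★★ **`SU(N)`, `N ≥ 2`, any `d`, `i ≠ j`, `-1/(6(d-1)N) < β < 0`: Class T is empty.** -/
theorem TiltedRP.isEmpty_tiltedClassState_of_neg_of_small_suN {d N : ℕ} {i j : Fin d} (hij : i ≠ j)
    (hN : 2 ≤ N) {β : ℝ} (hβ : β < 0) (hsmall : 6 * ((d - 1 : ℕ) : ℝ) * N * |β| < 1) :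
    IsEmpty (TiltedRP.TiltedClassState d i j (fundamentalRep (Fin N)) β) := by
  haveI : NeZero N := ⟨by omega⟩
  haveI : SecondCountableTopology (Matrix (Fin N) (Fin N) ℂ) :=
    inferInstanceAs (SecondCountableTopology (Fin N → Fin N → ℂ))
  haveI : SecondCountableTopology (Matrix.specialUnitaryGroup (Fin N) ℂ) :=
    Topology.IsEmbedding.subtypeVal.secondCountableTopology
  refine ⟨fun ω => ?_⟩
  have h := (TiltedRP.nonempty_tiltedClassState_iff_of_small (fundamentalRep (Fin N)) hij
    (continuous_fundamentalRep (Fin N)) hsmall).1 ⟨ω⟩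
  rcases h with h | h
  · exact absurd hβ (not_lt.2 h)
  · obtain ⟨z, ζ, hζ1, hz, -⟩ := IsSpecialUnitaryModel.exists_central (fundamentalRep (Fin N))
      (TorusAreaLaw.isSpecialUnitaryModel_fundamentalRep N) hN
    have h1 : (ζ • (1 : Matrix (Fin N) (Fin N) ℂ)) 0 0 = (1 : Matrix (Fin N) (Fin N) ℂ) 0 0 := by
      rw [← hz, h z]
    simp only [Matrix.smul_apply, Matrix.one_apply_eq, smul_eq_mul, mul_one] at h1
    exact hζ1 h1

end Unitary

end Summit.QuantumFields.GaugeBoot
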